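import Summits.QuantumFields.GaugeBoot.BaryonVertex
import Summits.QuantumFields.GaugeBoot.MultilinkSlabIntegral
import Summits.QuantumFields.GaugeBoot.TwistedSlabIntegral
import HarnessLib

/-!
# The baryonic theta observable of a periodic lattice and its slab transfer (gauge-boot, L3 negative supplement; SU(3) link reflection at `β < 0`, part 4)

HONEST FRAMING (cell `pub-gaugeboot`, page 1 of every file): the venture produces certified bounds
on lattice expectations at stated coupling, gauge group, dimension and torus size; NOT a mass gap,
NOT a continuum limit, NOT a string tension; NOT Yang–Mills-summit-bearing (barriers
`FixedCouplingUltralocality`, `PerturbativeInvisibility`). This is the test function of a NEGATIVE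
structural result (`FrameLinkRPNegativeBeta.lean`): link reflection positivity of the Wilson
measure fails at every `β < 0` for three-dimensional representations of determinant one.

On a periodic lattice `(A, e)` (`TiltedLatticeGauge.lean`) fix a site `x` and two directions `l ≠ m`.
The THETA GRAPH at `x` consists of the three lattice paths from `x` to `x + e_l`: around the
plaquette `(x; l, m)` (`x → x+e_m → x+e_m+e_l → x+e_l`), around the plaquette `(x-e_m; l, m)`
(`x → x-e_m → x-e_m+e_l → x+e_l`) and the link `(x, l)` itself — SEVEN links (`thetaLink`), an odd
number. For a three-dimensional representation `ρ` the **theta observable**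

  `Θ_x(U) = thetaForm (ρ(U_A)) (ρ(U_B)) (ρ(U_C))`                        (`thetaObs`)

(`Baryon.thetaForm`: the two `ε`-tensors at `x` and `x + e_l` contracting the three transporters
`U_A, U_B, U_C`) is the baryon–antibaryon (“theta”) spin network. This file proves:

* `thetaObs_congr` (it depends only on the seven link variables), `continuous_thetaObs`,
  `thetaObs_one` (`= 6` at `U ≡ 1`), **`thetaObs_gaugeAct`** (invariance under gauge
  transformations `U(z,n) ↦ g_z U(z,n) g_{z+e_n}⁻¹` with `det ρ(g_z) = 1` — `Baryon.thetaForm_conj`),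
  `integral_normSq_thetaObs_pos` (`0 < ∫ |Θ_x|² dμ₀`);
* **`theta_slab_integral`** / **`theta_slab_integral_frozen`** — the analogue of
  `TwistedSlab.slab_integral(_frozen)` for `Θ`: against one-link class weights `w(a_t Y_t⁻¹ b_t)` on a
  block `S` containing the seven (distinct) theta links,
  `∫ Θ_x(Y) ∏_{t∈S} w(a_t Y_t⁻¹ b_t) dμ(Y) = z^{|S|-7} c⁷ Θ_x(t ↦ b_t a_t)`
  (`MultilinkSlabIntegral.integral_prod_weight_mul_sum_prod_entry` on the entry expansion
  `Baryon.thetaForm_mul₃_eq_sum`): a slab of the Wilson measure transfers the theta observable one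
  layer down with the factor `z^{|S|-7} c_β⁷` — NEGATIVE at `β < 0` for `SU(3)`
  (`WilsonWeightNegativeBeta.lean`), because seven is odd.

Everything is `[folklore]` bookkeeping (strong-coupling baryon diagrams: M. Creutz, Quarks, Gluons
and Lattices (1983) Ch. 8; transfer-matrix form: K. Osterwalder, E. Seiler, Ann. Phys. 110 (1978)
440, §2).
-/

noncomputable section

open MeasureTheory Complex
open scoped Matrix ComplexConjugate
open Literature.MathematicalPhysics.QuantumFieldTheory (haarProbability)
open Literature.MathematicalPhysics.QuantumFieldTheory.LatticeRP (integral_mul_eq_of_dependsOn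
  integral_comp_eq_of_measurePreserving)
open Literature.RepresentationTheory.CompactGroups

namespace Summit.QuantumFields.GaugeBoot

namespace Baryon

open TiltedRP TwistedSlab

variable {A : Type*} [AddCommGroup A] {d : ℕ}

/-! ## The theta graph -/

/-- **The seven links of the theta graph at `x` in directions `l` (along) and `m` (across)**:
`(x,m), (x+e_m,l), (x+e_l,m)` (path `A`, the last traversed backwards), `(x-e_m,m)` (backwards),
`(x-e_m,l), (x-e_m+e_l,m)` (path `B`), and `(x,l)` (path `C`). [folklore] -/
def thetaLink (e : Fin d → A) (x : A) (l m : Fin d) : Fin 7 → Link A d :=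
  ![(x, m), (x + e m, l), (x + e l, m), (x - e m, m), (x - e m, l), (x - e m + e l, m), (x, l)]

/-- The orientation flags of the seven theta links (`true` = traversed backwards). [folklore] -/
def thetaInv : Fin 7 → Bool := ![false, false, true, true, false, false, false]

variable {G : Type*} [Group G] (ρ : G →* Matrix (Fin 3) (Fin 3) ℂ)

/-- **The theta value of seven link variables**: `thetaForm` of the three transporters
`v₀ v₁ v₂⁻¹`, `v₃⁻¹ v₄ v₅`, `v₆`. [folklore] -/
def thetaVal (v : Fin 7 → G) : ℂ :=
  thetaForm (ρ (v 0 * v 1 * (v 2)⁻¹)) (ρ ((v 3)⁻¹ * v 4 * v 5)) (ρ (v 6))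

/-- **The theta observable at `x`** (directions `l`, `m`) of a configuration. [folklore] -/
def thetaObs (e : Fin d → A) (x : A) (l m : Fin d) (V : Config A d G) : ℂ :=
  thetaVal ρ fun r => V (thetaLink e x l m r)

/-- The theta value in the oriented-matrix form of `MultilinkSlabIntegral.lean`:
`Θ(v) = thetaForm (M₀M₁M₂) (M₃M₄M₅) M₆`, `M_r = repOr (thetaInv r) v_r`. [folklore] -/
theorem thetaVal_eq_thetaForm_repOr (v : Fin 7 → G) :
    thetaVal ρ v = thetaForm
      (repOr ρ (thetaInv 0) (v 0) * repOr ρ (thetaInv 1) (v 1) * repOr ρ (thetaInv 2) (v 2))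
      (repOr ρ (thetaInv 3) (v 3) * repOr ρ (thetaInv 4) (v 4) * repOr ρ (thetaInv 5) (v 5))
      (repOr ρ (thetaInv 6) (v 6)) := by
  simp [thetaVal, thetaInv, repOr, map_mul]

/-- **The theta observable depends only on the seven theta link variables** (and on `x` only
through them): configurations agreeing on corresponding theta links have equal observables.
[folklore] -/
theorem thetaObs_congr {e : Fin d → A} {x x' : A} {l m : Fin d} {V V' : Config A d G}
    (h : ∀ r, V (thetaLink e x l m r) = V' (thetaLink e x' l m r)) :
    thetaObs ρ e x l m V = thetaObs ρ e x' l m V' := by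
  simp only [thetaObs, h]

/-- `Θ` at the trivial configuration is `6`. [folklore] -/
theorem thetaVal_one : thetaVal ρ (fun _ : Fin 7 => (1 : G)) = 6 := by
  simp [thetaVal, thetaForm_one]

/-! ## Gauge invariance -/

/-- A gauge transformation of a configuration of the periodic lattice:
`(g · V)(z, n) = g_z V(z, n) g_{z + e_n}⁻¹`. [folklore] -/
def gaugeAct (e : Fin d → A) (g : A → G) (V : Config A d G) : Config A d G :=
  fun t => g t.1 * V t * (g (t.1 + e t.2))⁻¹

/-- `gaugeAct` evaluated. [folklore] -/
@[simp] theorem gaugeAct_apply (e : Fin d → A) (g : A → G) (V : Config A d G) (z : A) (n : Fin d) :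
    gaugeAct e g V (z, n) = g z * V (z, n) * (g (z + e n))⁻¹ := rfl

/-- **Gauge invariance of the theta observable**: for `det ρ(g_z) = 1` (all `z`),
`Θ_x(g · V) = Θ_x(V)` — the three transporters go `x → x + e_l` and are conjugated to
`ρ(g_x) P ρ(g_{x+e_l})⁻¹`; `Baryon.thetaForm_conj`. [folklore] -/
theorem thetaObs_gaugeAct (e : Fin d → A) (g : A → G) (hdet : ∀ z, (ρ (g z)).det = 1)
    (x : A) (l m : Fin d) (V : Config A d G) :
    thetaObs ρ e x l m (gaugeAct e g V) = thetaObs ρ e x l m V := by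
  have e1 : x + e m + e l = x + e l + e m := add_right_comm _ _ _
  have e2 : x - e m + e m = x := sub_add_cancel _ _
  have e3 : x - e m + e l + e m = x + e l := by abel
  -- the three transporters are conjugated by `g x`, `g (x + e l)`
  have hA : gaugeAct e g V (x, m) * gaugeAct e g V (x + e m, l) * (gaugeAct e g V (x + e l, m))⁻¹ =
      g x * (V (x, m) * V (x + e m, l) * (V (x + e l, m))⁻¹) * (g (x + e l))⁻¹ := by
    simp only [gaugeAct_apply, e1, mul_inv_rev, inv_inv]; group
  have hB : (gaugeAct e g V (x - e m, m))⁻¹ * gaugeAct e g V (x - e m, l) *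
      gaugeAct e g V (x - e m + e l, m) =
      g x * ((V (x - e m, m))⁻¹ * V (x - e m, l) * V (x - e m + e l, m)) * (g (x + e l))⁻¹ := by
    simp only [gaugeAct_apply, e2, e3, mul_inv_rev, inv_inv]; group
  have hC : gaugeAct e g V (x, l) = g x * V (x, l) * (g (x + e l))⁻¹ := rfl
  have hdet' : (ρ (g (x + e l))⁻¹).det = 1 := by
    have h1 : ρ (g (x + e l))⁻¹ * ρ (g (x + e l)) = 1 := by rw [← map_mul, inv_mul_cancel, map_one]
    have h2 := congrArg Matrix.det h1
    rw [Matrix.det_mul, hdet, mul_one, Matrix.det_one] at h2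
    exact h2
  simp only [thetaObs, thetaVal, thetaLink, Matrix.cons_val_zero, Matrix.cons_val_one,
    Matrix.cons_val]
  rw [hA, hB, hC]
  simp only [map_mul]
  exact thetaForm_conj _ _ _ _ _ (hdet x) hdet'

/-! ## Continuity and non-vanishing -/

section Analysis

variable [TopologicalSpace G] [IsTopologicalGroup G]

omit [AddCommGroup A] in
/-- `thetaForm` of continuous matrix-valued maps is continuous. [folklore] -/
theorem continuous_thetaForm_comp {X : Type*} [TopologicalSpace X]
    {P Q S : X → Matrix (Fin 3) (Fin 3) ℂ} (hP : Continuous P) (hQ : Continuous Q) (hS : Continuous S) :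
    Continuous fun u => thetaForm (P u) (Q u) (S u) := by
  unfold thetaForm
  refine continuous_finsetSum _ fun a _ => continuous_finsetSum _ fun b _ =>
    continuous_finsetSum _ fun c _ => continuous_finsetSum _ fun a' _ =>
    continuous_finsetSum _ fun b' _ => continuous_finsetSum _ fun c' _ => ?_
  exact ((continuous_const.mul continuous_const).mul
    (((hP.matrix_elem a a').mul (hQ.matrix_elem b b')).mul (hS.matrix_elem c c')))

/-- The theta value is continuous in the seven variables. [folklore] -/
theorem continuous_thetaVal (hρ : Continuous ρ) : Continuous (thetaVal (G := G) ρ) := by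
  unfold thetaVal
  refine continuous_thetaForm_comp (hρ.comp ?_) (hρ.comp ?_) (hρ.comp ?_)
  · exact (((continuous_apply 0).mul (continuous_apply 1)).mul (continuous_apply 2).inv)
  · exact (((continuous_apply 3).inv.mul (continuous_apply 4)).mul (continuous_apply 5))
  · exact continuous_apply 6

/-- **The theta observable is continuous.** [folklore] -/
theorem continuous_thetaObs (hρ : Continuous ρ) (e : Fin d → A) (x : A) (l m : Fin d) :
    Continuous (thetaObs (G := G) ρ e x l m) :=
  (continuous_thetaVal ρ hρ).comp (continuous_pi fun _ => continuous_apply _)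

/-- A uniform bound on the theta observable (compact configuration space). [folklore] -/
theorem exists_norm_thetaObs_le [CompactSpace G] (hρ : Continuous ρ) (e : Fin d → A) (x : A)
    (l m : Fin d) : ∃ C : ℝ, ∀ V : Config A d G, ‖thetaObs ρ e x l m V‖ ≤ C := by
  obtain ⟨C, hC⟩ := (isCompact_univ.image (continuous_thetaObs ρ hρ e x l m)).isBounded.exists_norm_le
  exact ⟨C, fun V => hC _ ⟨V, Set.mem_univ _, rfl⟩⟩

variable [Fintype A] [CompactSpace G] [MeasurableSpace G] [BorelSpace G] [SecondCountableTopology G]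

/-- **`0 < ∫ |Θ_x|² dμ₀`**: the theta observable is continuous, equal to `6` at `U ≡ 1`, and the
product Haar measure charges non-empty open sets. [folklore] -/
theorem integral_normSq_thetaObs_pos (hρ : Continuous ρ) (e : Fin d → A) (x : A) (l m : Fin d) :
    0 < ∫ V, ‖thetaObs ρ e x l m V‖ ^ 2 ∂(productHaar A d G) := by
  haveI := isProbabilityMeasure_productHaar (A := A) (d := d) (G := G)
  haveI : IsProbabilityMeasure (haarProbability G) :=
    CompactGroup.isProbabilityMeasure_haarMeasure_top
  haveI : (haarProbability G).IsOpenPosMeasure := by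
    unfold haarProbability; infer_instance
  haveI : (productHaar A d G).IsOpenPosMeasure := by
    unfold productHaar; infer_instance
  have hc : Continuous fun V : Config A d G => ‖thetaObs ρ e x l m V‖ ^ 2 :=
    (continuous_thetaObs ρ hρ e x l m).norm.pow 2
  have hint : Integrable (fun V : Config A d G => ‖thetaObs ρ e x l m V‖ ^ 2) (productHaar A d G) :=
    hc.integrable_of_hasCompactSupport (HasCompactSupport.of_compactSpace _)
  rw [integral_pos_iff_support_of_nonneg (fun V => sq_nonneg _) hint]
  have hopen : IsOpen {V : Config A d G | 0 < ‖thetaObs ρ e x l m V‖ ^ 2} := isOpen_lt continuous_const hc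
  have h1 : (fun _ => (1 : G)) ∈ {V : Config A d G | 0 < ‖thetaObs ρ e x l m V‖ ^ 2} := by
    show 0 < ‖thetaObs ρ e x l m fun _ => (1 : G)‖ ^ 2
    have h6 : thetaObs ρ e x l m (fun _ => (1 : G)) = 6 := thetaVal_one ρ
    rw [h6]; norm_num
  refine lt_of_lt_of_le (hopen.measure_pos _ ⟨_, h1⟩) (measure_mono fun V hV => ?_)
  rw [Function.mem_support]
  exact ne_of_gt hV

omit [SecondCountableTopology G] in
/-- **`∫ conj Θ_x · Θ_x dμ₀` is the real number `∫ |Θ_x|² dμ₀`.** [folklore] -/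
theorem integral_conj_thetaObs_mul_self (e : Fin d → A) (x : A) (l m : Fin d) :
    ∫ V, conj (thetaObs ρ e x l m V) * thetaObs ρ e x l m V ∂(productHaar A d G) =
      ((∫ V, ‖thetaObs ρ e x l m V‖ ^ 2 ∂(productHaar A d G) : ℝ) : ℂ) := by
  rw [← integral_complex_ofReal]
  refine integral_congr_ae (ae_of_all _ fun V => ?_)
  dsimp only
  rw [Complex.conj_mul', Complex.ofReal_pow]

end Analysis

/-! ## The slab transfer of the theta observable -/

section Slab

variable [Fintype A] [DecidableEq A] [TopologicalSpace G] [IsTopologicalGroup G] [CompactSpace G]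
  [MeasurableSpace G] [BorelSpace G] [SecondCountableTopology G]

omit [Fintype A] [DecidableEq A] [TopologicalSpace G] [IsTopologicalGroup G] [CompactSpace G]
  [MeasurableSpace G] [BorelSpace G] [SecondCountableTopology G] [AddCommGroup A] in
/-- The substituted link matrix: `repOr o (b y⁻¹ a) = ρ(L) · repOr (!o) y · ρ(R)` with
`(L, R) = (b, a)` (`o = false`) or `(a⁻¹, b⁻¹)` (`o = true`). [folklore] -/
theorem repOr_conj_inv (o : Bool) (a b y : G) :
    repOr ρ o (b * y⁻¹ * a) =
      ρ (if o then a⁻¹ else b) * repOr ρ (!o) y * ρ (if o then b⁻¹ else a) := by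
  cases o
  · simp [repOr, map_mul]
  · simp [repOr, map_mul, mul_inv_rev, mul_assoc]

omit [Fintype A] [DecidableEq A] [TopologicalSpace G] [IsTopologicalGroup G] [CompactSpace G]
  [MeasurableSpace G] [BorelSpace G] [SecondCountableTopology G] [AddCommGroup A] in
/-- The transferred link matrix: `ρ(L R) = repOr o (b a)` for the same `(L, R)`. [folklore] -/
theorem rho_transfer_eq_repOr (o : Bool) (a b : G) :
    ρ ((if o then a⁻¹ else b) * (if o then b⁻¹ else a)) = repOr ρ o (b * a) := by
  cases o
  · simp [repOr]
  · simp [repOr, mul_inv_rev]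

variable {w : G → ℝ} (hw : Continuous w) (hinv : ∀ k, w k⁻¹ = w k) {c : ℂ}
  (hc : wAvg ρ w = c • (1 : Matrix (Fin 3) (Fin 3) ℂ)) (hρ : Continuous ρ)
  (e : Fin d → A) (x : A) (l m : Fin d)
include hw hinv hc hρ

/-- **The theta slab integral.** For a block `S` containing the seven DISTINCT theta links at `x`
and constants `a, b : Link → G`:
`∫ Θ_x(Y) ∏_{t ∈ S} w(a_t Y_t⁻¹ b_t) dμ(Y) = z^{|S|-7} c⁷ Θ_x(t ↦ b_t a_t)` (`z = ∫ w dk`).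
[folklore] -/
theorem theta_slab_integral (S : Finset (Link A d)) (a b : Link A d → G)
    (hinj : Function.Injective (thetaLink e x l m)) (hS : ∀ r, thetaLink e x l m r ∈ S) :
    ∫ Y, thetaObs ρ e x l m Y * ∏ t ∈ S, (w (a t * (Y t)⁻¹ * b t) : ℂ) ∂(productHaar A d G) =
      (∫ k, (w k : ℂ) ∂(haarProbability G)) ^ (S.card - 7) * c ^ 7 *
        thetaObs ρ e x l m (fun t => b t * a t) := by
  -- substitute `Y_t ↦ b_t Y_t⁻¹ a_t` on `S`
  have hsub := measurePreserving_slabSubst S a b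
  have hcont : Continuous fun Y : Config A d G =>
      thetaObs ρ e x l m Y * ∏ t ∈ S, (w (a t * (Y t)⁻¹ * b t) : ℂ) :=
    (continuous_thetaObs ρ hρ e x l m).mul (continuous_finsetProd _ fun t _ =>
      continuous_ofReal.comp (hw.comp ((continuous_const.mul (continuous_apply t).inv).mul
        continuous_const)))
  rw [← integral_comp_eq_of_measurePreserving hsub hcont.measurable]
  -- the integrand after substitution, in entry-expanded form
  set L : Fin 7 → G := fun r => if thetaInv r then (a (thetaLink e x l m r))⁻¹
    else b (thetaLink e x l m r) with hL
  set R : Fin 7 → G := fun r => if thetaInv r then (b (thetaLink e x l m r))⁻¹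
    else a (thetaLink e x l m r) with hR
  have hobs : ∀ Y : Config A d G, thetaObs ρ e x l m (slabSubst S a b Y) =
      ∑ ι : ThetaIdx, (thetaCoef ι : ℂ) *
        ∏ r : Fin 7, (ρ (L r) * repOr ρ (!thetaInv r) (Y (thetaLink e x l m r)) * ρ (R r))
          (thetaRow ι r) (thetaCol ι r) := by
    intro Y
    rw [thetaObs, thetaVal_eq_thetaForm_repOr]
    have hM : ∀ r, repOr ρ (thetaInv r) (slabSubst S a b Y (thetaLink e x l m r)) =
        ρ (L r) * repOr ρ (!thetaInv r) (Y (thetaLink e x l m r)) * ρ (R r) := by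
      intro r
      rw [slabSubst_apply_of_mem S a b Y (hS r), repOr_conj_inv]
    simp only [hM]
    exact thetaForm_mul₃_eq_sum (fun r => ρ (L r) * repOr ρ (!thetaInv r) (Y (thetaLink e x l m r)) *
      ρ (R r))
  have hW : ∀ Y : Config A d G, ∏ t ∈ S, (w (a t * (slabSubst S a b Y t)⁻¹ * b t) : ℂ) =
      ∏ t ∈ S, (w (Y t) : ℂ) := fun Y =>
    Finset.prod_congr rfl fun t ht => by rw [weightArg_slabSubst S a b Y ht]
  have hA : ∀ Y : Config A d G,
      thetaObs ρ e x l m (slabSubst S a b Y) * ∏ t ∈ S, (w (a t * (slabSubst S a b Y t)⁻¹ * b t) : ℂ) =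
      (∏ t ∈ S, (w (Y t) : ℂ)) * ∑ ι : ThetaIdx, (thetaCoef ι : ℂ) *
        ∏ r : Fin 7, (ρ (L r) * repOr ρ (!thetaInv r) (Y (thetaLink e x l m r)) * ρ (R r))
          (thetaRow ι r) (thetaCol ι r) := fun Y => by
    rw [hobs, hW, mul_comm]
  simp_rw [hA]
  rw [integral_prod_weight_mul_sum_prod_entry ρ hw hinv hc hρ S (thetaLink e x l m) hinj hS
    (fun r => !thetaInv r) L R (fun ι : ThetaIdx => (thetaCoef ι : ℂ)) (fun r ι => thetaRow ι r)
    (fun r ι => thetaCol ι r)]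
  congr 1
  -- refold the transferred observable
  rw [thetaObs, thetaVal_eq_thetaForm_repOr]
  have hT : ∀ r, ρ (L r * R r) = repOr ρ (thetaInv r) (b (thetaLink e x l m r) * a (thetaLink e x l m r)) :=
    fun r => rho_transfer_eq_repOr ρ (thetaInv r) _ _
  rw [thetaForm_mul₃_eq_sum (fun r => repOr ρ (thetaInv r)
    (b (thetaLink e x l m r) * a (thetaLink e x l m r)))]
  simp only [hT]

/-- **The theta slab integral with frozen neighbours.** Let the weights on the block `C` be
`w(a_t(U) U_t⁻¹ b_t(U))` with `a_t, b_t` continuous functions of the configuration OFF the block, let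
`g` be continuous and depend only on the configuration off the block, and let the seven distinct
theta links at `x` lie in `C`. Then
`∫ g(U) Θ_x(U) ∏_{t∈C} w(a_t(U) U_t⁻¹ b_t(U)) dμ(U) = z^{|C|-7} c⁷ ∫ g(U) Θ_x(t ↦ b_t(U) a_t(U)) dμ(U)`.
[folklore] -/
theorem theta_slab_integral_frozen (C : Finset (Link A d)) (a b : Link A d → Config A d G → G)
    (ha : ∀ t, Continuous (a t)) (hb : ∀ t, Continuous (b t))
    (haC : ∀ t, DependsOn (a t) ((Cᶜ : Finset (Link A d)) : Set (Link A d)))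
    (hbC : ∀ t, DependsOn (b t) ((Cᶜ : Finset (Link A d)) : Set (Link A d)))
    (g : Config A d G → ℂ) (hg : Continuous g)
    (hgC : DependsOn g ((Cᶜ : Finset (Link A d)) : Set (Link A d)))
    (hinj : Function.Injective (thetaLink e x l m)) (hS : ∀ r, thetaLink e x l m r ∈ C) :
    ∫ U, g U * thetaObs ρ e x l m U * ∏ t ∈ C, (w (a t U * (U t)⁻¹ * b t U) : ℂ) ∂(productHaar A d G) =
      (∫ k, (w k : ℂ) ∂(haarProbability G)) ^ (C.card - 7) * c ^ 7 *
        ∫ U, g U * thetaObs ρ e x l m (fun t => b t U * a t U) ∂(productHaar A d G) := by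
  set spl := Literature.MathematicalPhysics.QuantumFieldTheory.LatticeRP.splice (G := G) C with hspl
  set h : Config A d G → ℂ := fun U => g U * thetaObs ρ e x l m U *
    ∏ t ∈ C, (w (a t U * (U t)⁻¹ * b t U) : ℂ) with hh
  have hU : ∀ t, Continuous fun U : Config A d G => U t := fun t => continuous_apply t
  have hhc : Continuous h :=
    (hg.mul (continuous_thetaObs ρ hρ e x l m)).mul (continuous_finsetProd _ fun t _ =>
      continuous_ofReal.comp (hw.comp (((ha t).mul (hU t).inv).mul (hb t))))
  -- Fubini over the block
  have hsp : MeasurePreserving spl ((productHaar A d G).prod (productHaar A d G)) (productHaar A d G) := by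
    unfold productHaar
    exact Literature.MathematicalPhysics.QuantumFieldTheory.LatticeRP.measurePreserving_splice _ C
  have h1 : ∫ U, h U ∂(productHaar A d G) =
      ∫ U, ∫ Y, h (spl (U, Y)) ∂(productHaar A d G) ∂(productHaar A d G) := by
    rw [← integral_comp_eq_of_measurePreserving hsp hhc.measurable, integral_prod]
    exact ((hhc.comp (TwistedSlab.continuous_splice C)).integrable_of_hasCompactSupport
      (HasCompactSupport.of_compactSpace _))
  -- the integrand on the block, neighbours frozen at `U`
  have hon : ∀ U Y : Config A d G, ∀ t ∈ C, spl (U, Y) t = Y t := fun U Y t ht => by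
    rw [hspl, Literature.MathematicalPhysics.QuantumFieldTheory.LatticeRP.splice_apply, if_pos ht]
  have hoff : ∀ U Y : Config A d G, ∀ t ∈ ((Cᶜ : Finset (Link A d)) : Set (Link A d)),
      spl (U, Y) t = U t := fun U Y t ht => by
    have ht' : t ∉ C := by simpa using ht
    rw [hspl, Literature.MathematicalPhysics.QuantumFieldTheory.LatticeRP.splice_apply, if_neg ht']
  have h2 : ∀ U Y : Config A d G, h (spl (U, Y)) =
      g U * (thetaObs ρ e x l m Y * ∏ t ∈ C, (w (a t U * (Y t)⁻¹ * b t U) : ℂ)) := by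
    intro U Y
    rw [hh]
    simp only []
    rw [hgC (hoff U Y), mul_assoc, thetaObs_congr ρ (x' := x) (V' := Y) fun r => hon U Y _ (hS r)]
    congr 2
    exact Finset.prod_congr rfl fun t ht => by rw [haC t (hoff U Y), hbC t (hoff U Y), hon U Y t ht]
  have h3 : ∀ U : Config A d G, ∫ Y, h (spl (U, Y)) ∂(productHaar A d G) =
      (∫ k, (w k : ℂ) ∂(haarProbability G)) ^ (C.card - 7) * c ^ 7 *
        (g U * thetaObs ρ e x l m (fun t => b t U * a t U)) := by
    intro U
    simp_rw [h2 U]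
    rw [integral_const_mul, theta_slab_integral ρ hw hinv hc hρ e x l m C (fun t => a t U)
      (fun t => b t U) hinj hS]
    ring
  rw [h1]
  simp_rw [h3]
  rw [integral_const_mul]

end Slab

end Baryon

end Summit.QuantumFields.GaugeBoot

end
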